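import Summits.CriticalPhenomena.PercolationContinuityZ3.Theorems.PercNearOneGluingNoHeavyLowerTailCertRowsSHK
import Summits.CriticalPhenomena.PercolationContinuityZ3.Theorems.PercNearOneGluingNoHeavyLowerTailCertRowsPat
import HarnessLib

/-!
# `NoHeavyLowerTail` (stmt-CriticalPhenomena-4575) — certificate machine add-on: k-PETAL sunflower rows (any number of
# petals, either orientation, any sub-lattice of terminals) as checker row groups

Support file (prover prim-gen-kcluster gen 6, k-cluster line; `--supports stmt-CriticalPhenomena-4575`).  Two bookkeeping
definitions (`shkTail`, `shkRowsK`: the row group; `pairSum`: `Σ_{i<j} c_i c_j` of a list), no named facts, no sorries.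

WHY.  `CertRowsSHK` (gen 5) feeds a THREE-petal sunflower to the reflective checker as a group of two product rows whose
summed inequality is the sunflower row (`CertCheck.sound_of_rowSum`).  The rows that cut the surviving pseudo-laws of the
three-relay certificate searches (memo KCLUSTER-gen6.md §6; `PatternSunflower.dualSunflower_four`) are sunflowers with SIX
petals (the bottom four-point sunflower) or TEN (five points), so the checker needs the k-petal group:
* `shkRowsK A B [C₁,…,C_k] m w = [⟨C₁, C₂++⋯++C_k, A, B⟩, ⟨C₂, C₃++⋯++C_k, [], []⟩, …, ⟨C_k, [], [], []⟩]` (all with multiplier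
  `m`, weight `w`); in sum the group reads `w·m·Σ_{i<j} c_i c_j ≤ w·m·(μA·μB)` (`rowSum_shkRowsK_le`, from `pairSum cs ≤ μA μB`);
* `two_mul_pairSum` — `2 Σ_{i<j} c_i c_j = (Σ c)² − Σ c²`, the shape of `patternSunflower`'s conclusion;
* `patEvent_or`, `patEvent_anyTest` — the union pattern events of a list of tests (`CertCells.patEvent_not` from `CertRowsPat` for complements);
* **`shkRowsK_rowSum_le`** — for a test `φA` and a LIST of petal tests `φCs` with the decidable side conditions of
  `patternSunflower` (`MonoPat φA`, `MonoPat (φA ∨ φ)`, pairwise `DisjPat`, `DisjPat φA φ`), the group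
  `shkRowsK (cellsPat φA) (cellsPat φB) (φCs.map cellsPat) m w`, `φB = ¬(φA ∨ ⋁ φCs)`, satisfies the summed row inequality at
  the cell law of every weighted graph and placement — i.e. every pattern sunflower row is admissible checker input.
[cite: Gladkov2024StrongFKG, Thm. 2.1]
-/

noncomputable section

namespace Summit.CriticalPhenomena.PercolationContinuityZ3.Theorems

open MeasureTheory Set Literature.Probability.Percolation
open Literature.Probability.LatticeModels (prodBernoulli)
open scoped Classical BigOperators
open PatternCells CertCheck PatternSunflower

namespace CertCheck

variable (x : ℕ → ℝ)

/-! ## The k-petal row group -/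

/-- The tail rows `⟨C_i, C_{i+1}++⋯++C_k, [], []⟩` of a k-petal sunflower group. [this file] -/
def shkTail : List (List ℕ) → List ℕ → ℕ → List Row
  | [], _, _ => []
  | C :: rest, mult, wt => ⟨C, rest.flatten, [], [], mult, wt⟩ :: shkTail rest mult wt

/-- **A k-petal sunflower row as a group of product rows** sharing multiplier and weight: the head row carries `A·B`,
the others only products of petals; in sum `w·m·Σ_{i<j} c_i c_j ≤ w·m·(μA·μB)`. [this file] -/
def shkRowsK (A B : List ℕ) : List (List ℕ) → List ℕ → ℕ → List Row
  | [], _, _ => []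
  | C :: rest, mult, wt => ⟨C, rest.flatten, A, B, mult, wt⟩ :: shkTail rest mult wt

/-- `Σ_{i<j} c_i c_j` of a list. [folklore] -/
def pairSum : List ℝ → ℝ
  | [] => 0
  | c :: cs => c * cs.sum + pairSum cs

/-- `2 Σ_{i<j} c_i c_j = (Σ_i c_i)² − Σ_i c_i²`. [folklore] -/
theorem two_mul_pairSum (cs : List ℝ) : 2 * pairSum cs = cs.sum ^ 2 - (cs.map fun c => c ^ 2).sum := by
  induction cs with
  | nil => simp [pairSum]
  | cons c cs ih =>
    simp only [pairSum, List.sum_cons, List.map_cons]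
    nlinarith [ih]

/-- `linEval` of a flattened list of cell lists is the sum of the `linEval`s. [folklore] -/
theorem linEval_flatten (L : List (List ℕ)) : linEval x L.flatten = (L.map (linEval x)).sum := by
  induction L with
  | nil => unfold linEval; simp
  | cons C rest ih => rw [List.flatten_cons, linEval_append, ih, List.map_cons, List.sum_cons]

/-- The two row sums of the tail group: `w·m·pairSum` and `0`. [this file] -/
theorem rowSum_shkTail (Cs : List (List ℕ)) (mult : List ℕ) (wt : ℕ) :
    ((shkTail Cs mult wt).map fun r => (r.wt : ℝ) * evalM x r.mult * (linEval x r.e1 * linEval x r.e2)).sum =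
        (wt : ℝ) * evalM x mult * pairSum (Cs.map (linEval x)) ∧
      ((shkTail Cs mult wt).map fun r => (r.wt : ℝ) * evalM x r.mult * (linEval x r.e3 * linEval x r.e4)).sum = 0 := by
  induction Cs with
  | nil => simp [shkTail, pairSum]
  | cons C rest ih =>
    obtain ⟨ih1, ih2⟩ := ih
    have h0 : linEval x ([] : List ℕ) = 0 := by unfold linEval; simp
    refine ⟨?_, ?_⟩
    · simp only [shkTail, List.map_cons, List.sum_cons, ih1, linEval_flatten, pairSum]
      ring
    · simp only [shkTail, List.map_cons, List.sum_cons, ih2, h0]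
      ring

/-- **The summed inequality of a `shkRowsK` group follows from the sunflower inequality of its cell sums**
`Σ_{i<j} c_i c_j ≤ μA · μB`. [this file] -/
theorem rowSum_shkRowsK_le (hx : ∀ i, 0 ≤ x i) (A B : List ℕ) (Cs : List (List ℕ)) (mult : List ℕ) (wt : ℕ)
    (hshk : pairSum (Cs.map (linEval x)) ≤ linEval x A * linEval x B) :
    ((shkRowsK A B Cs mult wt).map fun r => (r.wt : ℝ) * evalM x r.mult * (linEval x r.e1 * linEval x r.e2)).sum ≤
      ((shkRowsK A B Cs mult wt).map fun r => (r.wt : ℝ) * evalM x r.mult * (linEval x r.e3 * linEval x r.e4)).sum := by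
  cases Cs with
  | nil => simp [shkRowsK]
  | cons C rest =>
    obtain ⟨t1, t2⟩ := rowSum_shkTail x rest mult wt
    simp only [shkRowsK, List.map_cons, List.sum_cons, t1, t2, linEval_flatten]
    simp only [List.map_cons, pairSum] at hshk
    have hw : 0 ≤ (wt : ℝ) * evalM x mult := mul_nonneg (Nat.cast_nonneg _) (evalM_nonneg x hx _)
    nlinarith [mul_le_mul_of_nonneg_left hshk hw]

end CertCheck

namespace PatternSunflower

variable {n : ℕ}

/-- The disjunction of a list of pattern tests. [folklore] -/
def anyTest (φs : List (ℕ → Bool)) (m : ℕ) : Bool := φs.any fun φ => φ m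

/-- The pattern event of a disjunction of two tests is the union. [this file] -/
theorem patEvent_or (v : Fin 5 → Fin n) (φ ψ : ℕ → Bool) :
    PatEvent v (fun m => φ m || ψ m) = PatEvent v φ ∪ PatEvent v ψ := by
  ext ω
  obtain ⟨m, hm, hcell⟩ := exists_mem_cell v ω
  simp only [Set.mem_union, mem_patEvent_iff v _ hm hcell, Bool.or_eq_true]

/-- The pattern event of the disjunction of a list of tests is the union over the list. [this file] -/
theorem patEvent_anyTest (v : Fin 5 → Fin n) (φs : List (ℕ → Bool)) :
    PatEvent v (anyTest φs) = ⋃ i : Fin φs.length, PatEvent v (φs.get i) := by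
  ext ω
  obtain ⟨m, hm, hcell⟩ := exists_mem_cell v ω
  simp only [Set.mem_iUnion, mem_patEvent_iff v _ hm hcell, anyTest, List.any_eq_true]
  constructor
  · rintro ⟨φ, hφ, h⟩
    obtain ⟨i, rfl⟩ := List.mem_iff_get.1 hφ
    exact ⟨i, h⟩
  · rintro ⟨i, h⟩
    exact ⟨φs.get i, List.get_mem φs i, h⟩

/-- **k-petal pattern sunflower rows are admissible checker input.**  For a test `φA` and a list of petal tests `φCs` with
`MonoPat φA`, `MonoPat (φA ∨ φ)`, pairwise `DisjPat` and `DisjPat φA φ` (all decidable), at the cell law `x m = μ(Cell v m)` of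
any weighted graph and placement `v`, the group `shkRowsK (cellsPat φA) (cellsPat φB) (φCs.map cellsPat) mult wt` with
`φB = ¬(φA ∨ ⋁ φCs)` satisfies the summed row inequality of `CertCheck.sound_of_rowSum`.
[cite: Gladkov2024StrongFKG, Thm. 2.1] -/
theorem shkRowsK_rowSum_le (w : Sym2 (Fin n) → unitInterval) (v : Fin 5 → Fin n) (φA : ℕ → Bool)
    (φCs : List (ℕ → Bool)) (hA : MonoPat φA = true)
    (hAC : ∀ φ ∈ φCs, MonoPat (fun m => φA m || φ m) = true)
    (hdisj : φCs.Pairwise fun φ ψ => DisjPat φ ψ = true)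
    (hdisjA : ∀ φ ∈ φCs, DisjPat φA φ = true) (mult : List ℕ) (wt : ℕ) :
    let x : ℕ → ℝ := fun m => (prodBernoulli w).real (Cell v m)
    let rows := CertCheck.shkRowsK (cellsPat φA) (cellsPat fun m => !(φA m || anyTest φCs m))
      (φCs.map cellsPat) mult wt
    (rows.map fun r => (r.wt : ℝ) * evalM x r.mult * (linEval x r.e1 * linEval x r.e2)).sum ≤
      (rows.map fun r => (r.wt : ℝ) * evalM x r.mult * (linEval x r.e3 * linEval x r.e4)).sum := by
  intro x rows
  have hx : ∀ i, 0 ≤ x i := fun i => measureReal_nonneg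
  apply CertCheck.rowSum_shkRowsK_le x hx
  -- the sunflower on pattern events indexed by `Fin k`
  set k := φCs.length with hk
  have hsf := patternSunflower w v (Finset.univ : Finset (Fin k)) φA (fun i => φCs.get i) hA
    (fun i _ => hAC _ (List.get_mem φCs i))
    (fun i _ j _ hij => by
      have hne : (i : ℕ) ≠ j := fun h => hij (Fin.ext h)
      rcases Nat.lt_or_gt_of_ne hne with hlt | hgt
      · exact List.Pairwise.rel_get_of_lt hdisj hlt
      · -- symmetric: `DisjPat` is symmetric in its arguments
        have h := List.Pairwise.rel_get_of_lt hdisj hgt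
        unfold DisjPat at h ⊢
        rw [List.all_eq_true] at h ⊢
        intro m hm
        have := h m hm
        simp only [Bool.not_and, Bool.or_eq_true, Bool.not_eq_true'] at this ⊢
        tauto)
    (fun i _ => hdisjA _ (List.get_mem φCs i))
  -- rewrite the cell sums
  have hmap : (List.map cellsPat φCs).map (linEval x) = List.ofFn fun i : Fin k => (prodBernoulli w).real (PatEvent v (φCs.get i)) := by
    apply List.ext_get
    · simp [hk]
    · intro i h1 h2
      simp only [List.get_eq_getElem, List.getElem_map, List.getElem_ofFn]
      exact linEval_cellsPat _ v _
  have hsum : (List.ofFn fun i : Fin k => (prodBernoulli w).real (PatEvent v (φCs.get i))).sum =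
      ∑ i : Fin k, (prodBernoulli w).real (PatEvent v (φCs.get i)) := by
    rw [List.sum_ofFn]
  have hsq : ((List.ofFn fun i : Fin k => (prodBernoulli w).real (PatEvent v (φCs.get i))).map fun c => c ^ 2).sum =
      ∑ i : Fin k, (prodBernoulli w).real (PatEvent v (φCs.get i)) ^ 2 := by
    rw [List.map_ofFn, List.sum_ofFn]; rfl
  have hB : (prodBernoulli w).real (PatEvent v fun m => !(φA m || anyTest φCs m)) =
      (prodBernoulli w).real (PatEvent v φA ∪ ⋃ i : Fin k, PatEvent v (φCs.get i))ᶜ := by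
    rw [CertCells.patEvent_not, patEvent_or, patEvent_anyTest]
  simp only [Finset.mem_univ, Set.iUnion_true] at hsf
  rw [linEval_cellsPat, linEval_cellsPat, hmap, hB]
  have h2 := two_mul_pairSum (List.ofFn fun i : Fin k => (prodBernoulli w).real (PatEvent v (φCs.get i)))
  rw [hsum, hsq] at h2
  linarith

end PatternSunflower

end Summit.CriticalPhenomena.PercolationContinuityZ3.Theorems

end
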